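import Literature.AnabelianGeometry.SemiGraphs.TemperedLevelData
import HarnessLib

/-!
# Finite-level data of a chart with the branch identification for COMPACT stabilisers (v4 of (I4′))

Mochizuki, *Semi-graphs of anabelioids*, Publ. RIMS **42** (2006), §3, proof of Thm. 3.7 (iii),
author's manuscript p. 41 [cite: MochizukiSemiAnbd2006, Thm 3.7(iii) p.41]: "for i ∈ I, let us write
`H_i ⊆ π₁^temp(𝒢)/π₁^temp(𝒢_{∞,i})` for the image of `H` … `H` is contained in some edge-like subgroup"
— throughout, `H` is a COMPACT subgroup of `π₁^temp(𝒢)`.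

ADDITIVE v4 of abc-iut-L3-t10's `FiniteLevelData` (`TemperedLevelData.lean`, v3 FROZEN p411276, never
edited), cell ruling α12-1 on finding F-t6g3-1 (seat abc-iut-L3-t6): the v3 field (I4′)
`stabBranchPair'` quantifies its branch-coset conclusion over ALL elements `g` of the chart group with an
injection `ιQ : c.G → Q`; combined with total estrangement this forces the finite-level actions to be
jointly faithful (`FiniteLevelData.eq_one_of_levelAct_eq_one`, TemperedLevelActFaithful.lean), which the
Galois towers available in the tree (towers over a Galois-countability witness, [IUTchI] Rmk 2.5.3 (T2):
LOCAL splitting, not cofinality) do not supply.  Print only ever moves the compact `H`; accordingly the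
structure `FiniteLevelDataCpt` below carries, instead of (I4′), the field (I4′)_cpt `stabBranchPairCpt'`:
the SAME text prefixed by `∀ (C : Subgroup c.G), IsCompact (C : Set c.G) →`, with `Set.InjOn ιQ C` in
place of `Function.Injective ιQ` and the conclusion quantified over `g ∈ C`.  Every other field is the
v3 text verbatim, and `FiniteLevelData.toCpt` turns v3 data into v4 data (an injection is injective on
every subset), so every v3 producer feeds the v4 consumers (abc-iut-L3-t11's
`noFixedBranchPairSystem_of_isTotallyEstranged_cpt`, abc-iut-L3-t10's / w4-d064's
`FiniteLevelDataCpt.compactInVerticial`, the At-chain twin P3′).  Typed ≠ proved: this file states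
data and one structural conversion; nothing here bears on [IUTchIII] Cor. 3.12.
-/

namespace Literature.AnabelianGeometry.SemiGraphs

namespace ProfiniteSemiGraph

open CategoryTheory Topology

universe v u

variable {𝒢 : ProfiniteSemiGraph.{u}}

/-- **The finite-level data of a chart, compact form (v4)** ([SemiAnbd] proof of Thm. 3.7 (iii),
p. 41, with Comments (6)(b)): the tree-level data `VerticialLevelData` EXTENDED by the finite graphs
`level j` (the underlying semi-graphs `𝔾_j` of the finite étale Galois coverings `𝒢_j`), the universal
graph-coverings `quot j : tree j ⟶ level j` (immersions), the induced actions `levelAct j` and transition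
morphisms `levelTrans` with their commuting squares — the v3 fields of `FiniteLevelData` verbatim — and
the branch-level identification **(I4′)_cpt** `stabBranchPairCpt'` (Remark 2.2.1 at branch level for the
elements of a COMPACT subgroup `C`: after a homomorphism `ιQ` of `π₁^temp(𝒢)` to an overgroup `Q`
INJECTIVE ON `C`, the elements of `C` fixing a compatible system `(w_i; β_i ≠ β'_i)` of a vertex with two
distinct abutting branches of the finite levels lie in `ψ(x Π_b x⁻¹) ∩ ψ(x' Π_{b'} x'⁻¹)` for an injective
`ψ : Π_v → Q` and two distinct branch-cosets at `v`), which total estrangement turns into "no nontrivial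
compact subgroup fixes such a system", whence (∗_j) for compact subgroups — all that
`VerticialLevelData.compactInVerticial_of_hstar` consumes. [cite: MochizukiSemiAnbd2006, Thm 3.7(iii) p.41] -/
structure FiniteLevelDataCpt (𝒢 : ProfiniteSemiGraph.{u}) (c : TemperedPiChart 𝒢)
    extends VerticialLevelData.{v} 𝒢 c where
  /-- the finite semi-graphs `𝔾_j` underlying the finite étale Galois coverings `𝒢_j → 𝒢` -/
  level : J → SemiGraph.{u}
  [finiteVertex : ∀ j, Finite (level j).Vertex]
  [finiteBranch : ∀ j, Finite (level j).Branch]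
  /-- the universal graph-coverings `𝒢_{∞,j} → 𝔾_j` -/
  quot : ∀ j, tree j ⟶ level j
  /-- graph-coverings are immersions -/
  quot_isImmersion : ∀ j, SemiGraph.IsImmersion (quot j)
  /-- the induced actions on the finite levels -/
  levelAct : ∀ j, c.G →* Aut (level j)
  /-- `quot` is equivariant -/
  act_quot : ∀ (j : J) (g : c.G), (act j g).hom ≫ quot j = quot j ≫ (levelAct j g).hom
  /-- the transition morphisms `𝔾_j → 𝔾_i`, `i ≤ j` -/
  levelTrans : ∀ ⦃i j : J⦄, i ≤ j → (level j ⟶ level i)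
  /-- functoriality: identities -/
  levelTrans_id : ∀ j, levelTrans (le_refl j) = 𝟙 (level j)
  /-- functoriality: composition -/
  levelTrans_comp : ∀ ⦃i j k : J⦄ (hij : i ≤ j) (hjk : j ≤ k),
    levelTrans hjk ≫ levelTrans hij = levelTrans (hij.trans hjk)
  /-- the finite-level transition morphisms are equivariant -/
  levelTrans_act : ∀ ⦃i j : J⦄ (h : i ≤ j) (g : c.G),
    (levelAct j g).hom ≫ levelTrans h = levelTrans h ≫ (levelAct i g).hom
  /-- the transition morphisms of the trees cover those of the finite levels -/
  trans_quot : ∀ ⦃i j : J⦄ (h : i ≤ j), trans h ≫ quot i = quot j ≫ levelTrans h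
  /-- (I4′)_cpt Remark 2.2.1 at branch level for COMPACT subgroups (ruling α12-1): for every compact
  `C ≤ π₁^temp(𝒢)`, after a homomorphism `ιQ : π₁^temp(𝒢) → Q` injective on `C`, the elements of `C`
  stabilising a compatible finite-level branch-pair system lie in two distinct branch-conjugates -/
  stabBranchPairCpt' : ∀ (C : Subgroup c.G), IsCompact (C : Set c.G) →
    ∀ (j₀ : J) (w : ∀ i : {i : J // j₀ ≤ i}, (level i.1).Vertex)
    (β β' : ∀ i : {i : J // j₀ ≤ i}, (level i.1).Branch),
    (∀ i, β i ≠ β' i ∧ (level i.1).abuts (β i) = some (w i) ∧ (level i.1).abuts (β' i) = some (w i)) →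
    (∀ ⦃i i' : {i : J // j₀ ≤ i}⦄ (h : i.1 ≤ i'.1), (levelTrans h).vertexMap (w i') = w i ∧
      (levelTrans h).branchMap (β i') = β i ∧ (levelTrans h).branchMap (β' i') = β' i) →
    ∃ (Q : Type u) (_ : Group Q) (ιQ : c.G →* Q) (v : 𝒢.graph.Vertex) (b b' : 𝒢.graph.Branch)
      (hb : 𝒢.graph.abuts b = some v) (hb' : 𝒢.graph.abuts b' = some v) (ψ : 𝒢.Gv v →* Q) (x x' : 𝒢.Gv v),
      Set.InjOn ιQ C ∧ Function.Injective ψ ∧ (b' ≠ b ∨ x⁻¹ * x' ∉ 𝒢.branchSubgroup b v hb) ∧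
      ∀ g ∈ C, (∀ i, (levelAct i.1 g).hom.vertexMap (w i) = w i ∧
        (levelAct i.1 g).hom.branchMap (β i) = β i ∧ (levelAct i.1 g).hom.branchMap (β' i) = β' i) →
        ιQ g ∈ ((𝒢.branchSubgroup b v hb).map (MulAut.conj x).toMonoidHom).map ψ ⊓
          ((𝒢.branchSubgroup b' v hb').map (MulAut.conj x').toMonoidHom).map ψ

attribute [instance] FiniteLevelDataCpt.finiteVertex FiniteLevelDataCpt.finiteBranch

/-- **v3 ⇒ v4**: finite-level data with the identification (I4′) for ALL elements (an injective `ιQ`)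
yields finite-level data with (I4′)_cpt (injective on every compact subgroup): every v3 producer
feeds the v4 consumers. [cite: MochizukiSemiAnbd2006, Thm 3.7(iii) p.41] -/
def FiniteLevelData.toCpt {c : TemperedPiChart 𝒢} (D : FiniteLevelData.{v} 𝒢 c) :
    FiniteLevelDataCpt.{v} 𝒢 c where
  toVerticialLevelData := D.toVerticialLevelData
  level := D.level
  quot := D.quot
  quot_isImmersion := D.quot_isImmersion
  levelAct := D.levelAct
  act_quot := D.act_quot
  levelTrans := D.levelTrans
  levelTrans_id := D.levelTrans_id
  levelTrans_comp := D.levelTrans_comp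
  levelTrans_act := D.levelTrans_act
  trans_quot := D.trans_quot
  stabBranchPairCpt' C _ j₀ w β β' hpair hcompat := by
    obtain ⟨Q, _, ιQ, v, b, b', hb, hb', ψQ, x, x', hι, hψQ, hne, hst⟩ :=
      D.stabBranchPair' j₀ w β β' hpair hcompat
    exact ⟨Q, inferInstance, ιQ, v, b, b', hb, hb', ψQ, x, x', hι.injOn, hψQ, hne,
      fun g _ hg => hst g hg⟩

/-- `toCpt` keeps the tree-level data. [cite: MochizukiSemiAnbd2006, Thm 3.7(iii) p.41] -/
@[simp] theorem FiniteLevelData.toCpt_toVerticialLevelData {c : TemperedPiChart 𝒢}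
    (D : FiniteLevelData.{v} 𝒢 c) : D.toCpt.toVerticialLevelData = D.toVerticialLevelData := rfl

/-- `toCpt` keeps the finite levels. [cite: MochizukiSemiAnbd2006, Thm 3.7(iii) p.41] -/
@[simp] theorem FiniteLevelData.toCpt_level {c : TemperedPiChart 𝒢} (D : FiniteLevelData.{v} 𝒢 c) :
    D.toCpt.level = D.level := rfl

/-- `toCpt` keeps the level actions. [cite: MochizukiSemiAnbd2006, Thm 3.7(iii) p.41] -/
@[simp] theorem FiniteLevelData.toCpt_levelAct {c : TemperedPiChart 𝒢} (D : FiniteLevelData.{v} 𝒢 c) :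
    D.toCpt.levelAct = D.levelAct := rfl

/-- `toCpt` keeps the level transitions. [cite: MochizukiSemiAnbd2006, Thm 3.7(iii) p.41] -/
theorem FiniteLevelData.toCpt_levelTrans {c : TemperedPiChart 𝒢} (D : FiniteLevelData.{v} 𝒢 c)
    ⦃i j : D.J⦄ (h : i ≤ j) : D.toCpt.levelTrans h = D.levelTrans h := rfl

/-- `toCpt` keeps the graph-coverings. [cite: MochizukiSemiAnbd2006, Thm 3.7(iii) p.41] -/
@[simp] theorem FiniteLevelData.toCpt_quot {c : TemperedPiChart 𝒢} (D : FiniteLevelData.{v} 𝒢 c) :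
    D.toCpt.quot = D.quot := rfl

end ProfiniteSemiGraph

end Literature.AnabelianGeometry.SemiGraphs
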